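import Literature.AnabelianGeometry.EtaleTheta.Discharge.Sec4BaseEquivOfTemperoids
import Literature.AnabelianGeometry.EtaleTheta.Discharge.Sec4GaloisSurjNatural
import Literature.AnabelianGeometry.EtaleTheta.Discharge.Sec5OfTemperoidModelData

/-!
# [EtTh] Thm. 4.4 (i): `Ψ^bs` induces `H_{⊙,1} ≅ H_{⊙,2}` — T44-L09 `HodotCompatible` and T44-L09c `GaloisCompatible`
# PROVED for settings whose base category is the temperoid `B^temp(Π^tp_X)`

S. Mochizuki, *The étale theta function and its Frobenioid-theoretic manifestations*, Publ. RIMS **45** (2009)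
[MochizukiEtTh2009], Thm. 4.4 (i) p.320 (PDF p.94): «`Ψ^bs` induces an isomorphism `H_{⊙,1} ⥲ H_{⊙,2}`, which is
well-defined up to composition with inner automorphisms of `Π^tp_{X_i}`»; proof p.321 (PDF p.95) ll.5–6: «The
portion of assertion (i) concerning `Ψ^bs` follows immediately from the theory of temperoids [cf. [SemiAnbd],
Proposition 3.2; Theorem A.4]».  S. Mochizuki, *Semi-graphs of anabelioids*, Publ. RIMS **42** (2006)
[MochizukiSemiAnbd2006], Prop. 3.2 p.35.

abc-iut cell, layer L2, ROW «SUBDAG-EtTh-Thm44 T44-L09 / T44-L09c AT THE TEMPEROID BASE via [SemiAnbd] Prop. 3.2»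
(abc-iut-L2-lead gen 3 RULINGS #10, 05:24Z; seat abc-iut-w5-d013 gen 3), FILE 2 of 2.  For bi-Kummer settings
`S₁`, `S₂` (abc-iut-L2-t3's `BiKummerSetting`) whose base categories ARE the temperoids `B^temp(Π^tp_{X_i})`
(abc-iut-L3's `BTemp Xᵢ.Pi`) and whose Galois data are the temperoid's — Galois objects of [SemiAnbd] Def. 3.1 (iv)
and the Galois surjections `galoisSurjOf` of `Sec4GaloisSurjNaturalModel` (abc-iut-w5-d013 gen 2) —, as is
DEFINITIONALLY the case for abc-iut-L2-t4's `BiKummerSetting.mkOfTemperoid`, and for ANY hypothesis package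
`h : Thm44Hyp S₁ S₂` of Thm. 4.4 (abc-iut-L2-t3, `BiKummerRoots.lean`):
* `Thm44Hyp.exists_res_iso` — THE PIN «`Ψ^bs ≅ B^temp(φ)`»: `h.Ψbs.functor ≅ BTemp.res φ` for an ISOMORPHISM
  `φ : Π^tp_{X₂} ⥲ Π^tp_{X₁}` of tempered groups ([SemiAnbd] Prop. 3.2, via FILE 1 `BTemp.exists_res_iso_of_equivalence`
  over abc-iut-L3-d2's `TemperoidHomEqRes_holds`);
* `Thm44Hyp.isGalois_map_ofTemperoid` — `Ψ` carries Galois objects to Galois objects (binder `hG`);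
* `Thm44Hyp.hodot_eq_comap` — `H_{⊙,2} = φ⁻¹(H_{⊙,1})` ON THE NOSE; hence
  **`Thm44Hyp.hodotCompatible_ofTemperoid : h.HodotCompatible`** (SUBDAG-EtTh-Thm44 row T44-L09) with
  `θ := φ⁻¹ : Π^tp_{X₁} ≃ₜ* Π^tp_{X₂}`;
* `Thm44Hyp.transportBaseAut_galoisSurj` — the transport law `transportBaseAut_A(galoisSurj₁ g) =
  galoisSurj₂(c·θ(g)·c⁻¹)` (binder `hT`); hence **`Thm44Hyp.galoisCompatible_ofTemperoid : h.GaloisCompatible`**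
  (row T44-L09c) by gen 2's `Thm44Hyp.galoisCompatible_of` — NO residual binder;
* consequences by name: `preservesAmple_ofTemperoid` (T44-L08), `thm44_i_ofTemperoid` (Thm. 4.4 (i) from
  `IsFrobenioid C₂` + T44-L03 only), and the literal instances `…_mkOfTemperoid` for L2-t4's settings.
The hypotheses `hg₁`/`hI₂`/`hg₂` say exactly «the setting's Galois data are the temperoid's» (`⟨hA, rfl⟩` / `id`
at `mkOfTemperoid`); they are equations between data, not named facts.  Proof-only, no definition; nothing here
bears on [IUTchIII] Cor. 3.12 (refereed pre-IUT material); typed ≠ proved except for the theorems of this file.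
-/

noncomputable section

namespace Literature.AnabelianGeometry.EtaleTheta

open CategoryTheory Opposite Literature.AlgebraicGeometry.Frobenioids Literature.AnabelianGeometry.SemiGraphs
  Literature.AnabelianGeometry.SemiGraphs.GaloisObjects

namespace BiKummerSetting

universe u₀ v₀ w

variable {K : Type u₀} [Field K] {K' : Type u₀} [Field K'] {X₁ : SemiGraphs.TemperedArithmeticGroup.{u₀} K}
  {X₂ : SemiGraphs.TemperedArithmeticGroup.{u₀} K'} {D₀ : Type u₀} [Category.{v₀} D₀] {D₀' : Type u₀}
  [Category.{v₀} D₀'] {V : FrdIMonoidStub.{w}} {T₁ : RealifiedDivisorMonoids (D₀ := D₀) V}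
  {T₂ : RealifiedDivisorMonoids (D₀ := D₀') V} {VD₁ : FrdICatStub.{u₀ + 1, u₀, w} (BTemp X₁.Pi)}
  {VD₂ : FrdICatStub.{u₀ + 1, u₀, w} (BTemp X₂.Pi)}
  {S₁ : BiKummerSetting X₁ T₁ (BTemp X₁.Pi) VD₁} {S₂ : BiKummerSetting X₂ T₂ (BTemp X₂.Pi) VD₂}

section OfTemperoid

/-! ### The pin `Ψ^bs ≅ B^temp(φ)` ([SemiAnbd] Prop. 3.2) -/

/-- **THE PIN «`Ψ^bs ≅ B^temp(φ)`» for the base equivalence of Thm. 4.4** (proof p.321 ll.5–6 «follows immediately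
from the theory of temperoids [cf. [SemiAnbd], Proposition 3.2 …]»): for settings over the temperoids
`B^temp(Π^tp_{X_i})`, `Ψ^bs : B^temp(Π^tp_{X₁}) ≌ B^temp(Π^tp_{X₂})` is `B^temp(φ)` for mutually inverse continuous
homomorphisms `φ : Π^tp_{X₂} → Π^tp_{X₁}`, `ψ : Π^tp_{X₁} → Π^tp_{X₂}` (`Π^tp_{X_i}` tempered and Galois-countable,
[SemiAnbd] Ex. 3.10 / [IUTchI] Rmk. 2.5.3). [cite: MochizukiEtTh2009, Thm 4.4 (i) p.321 (PDF p.95)] -/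
theorem Thm44Hyp.exists_res_iso (h : Thm44Hyp S₁ S₂) :
    ∃ (φ : X₂.Pi →ₜ* X₁.Pi) (ψ : X₁.Pi →ₜ* X₂.Pi), (∀ x, ψ (φ x) = x) ∧ (∀ y, φ (ψ y) = y) ∧
      Nonempty (h.Ψbs.functor ≅ BTemp.res φ) ∧ Nonempty (h.Ψbs.inverse ≅ BTemp.res ψ) := by
  haveI := X₁.secondCountableTopology
  haveI := X₂.secondCountableTopology
  exact BTemp.exists_res_iso_of_equivalence X₁.isTempered X₂.isTempered h.Ψbs

/-! ### `hG`: `Ψ` preserves Galois objects -/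

/-- **`Ψ(A)` is Galois for Galois `A`** (Thm. 4.4 (i)/(iii), the binder `hG` of `galoisCompatible_of`): `(Ψ A)^bs ≅
Ψ^bs(A^bs) ≅ B^temp(φ)(A^bs)` and `B^temp(φ)` of a continuous surjection preserves Galois objects.
[cite: MochizukiEtTh2009, Thm 4.4 (i) p.320 (PDF p.94)] -/
theorem Thm44Hyp.isGalois_map_ofTemperoid (h : Thm44Hyp S₁ S₂)
    (hg₁ : ∀ (A : BTemp X₁.Pi) (hA : S₁.IsGaloisObj A),
      ∃ hA' : SemiGraphs.IsGaloisObj A, S₁.galoisSurj A hA = galoisSurjOf X₁.isTempered A hA')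
    (hI₂ : ∀ B : BTemp X₂.Pi, SemiGraphs.IsGaloisObj B → S₂.IsGaloisObj B)
    (A : S₁.C) (hA : S₁.IsGalois A) : S₂.IsGalois (h.Ψ.functor.obj A) := by
  obtain ⟨φ, ψ, -, hφψ, ⟨η⟩, -⟩ := h.exists_res_iso
  obtain ⟨hA', -⟩ := hg₁ (S₁.base.obj A) hA
  exact hI₂ _ (isGaloisObj_of_iso X₂.isTempered (h.cmp A).symm
    (isGaloisObj_of_iso_res X₁.isTempered X₂.isTempered φ (fun x => ⟨ψ x, hφψ x⟩) η _ hA'))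

/-! ### T44-L09: `H_{⊙,2} = φ⁻¹(H_{⊙,1})`, i.e. `θ(H_{⊙,1}) = H_{⊙,2}` for `θ = φ⁻¹` -/

/-- **`H_{⊙,2} = φ⁻¹(H_{⊙,1})` ON THE NOSE** for any `Ψ^bs ≅ B^temp(φ)`, `φ` a continuous surjection: `H_{⊙,i} =
Ker(Π^tp_{X_i} ↠ Aut(A_{⊙,i}^bs)) = N_{A_{⊙,i}^bs}`, `Ψ^bs(A_{⊙,1}^bs) ≅ A_{⊙,2}^bs` (`Thm44Hyp.mapsAodot`), kernels
are invariant under isomorphism and `N_{B^temp(φ)(A)} = φ⁻¹(N_A)` (gen 2's `ker_galoisSurjOf_res`).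
[cite: MochizukiEtTh2009, Thm 4.4 (i) p.320 (PDF p.94)] -/
theorem Thm44Hyp.hodot_eq_comap (h : Thm44Hyp S₁ S₂)
    (hg₁ : ∀ (A : BTemp X₁.Pi) (hA : S₁.IsGaloisObj A),
      ∃ hA' : SemiGraphs.IsGaloisObj A, S₁.galoisSurj A hA = galoisSurjOf X₁.isTempered A hA')
    (hg₂ : ∀ (B : BTemp X₂.Pi) (hB : S₂.IsGaloisObj B),
      ∃ hB' : SemiGraphs.IsGaloisObj B, S₂.galoisSurj B hB = galoisSurjOf X₂.isTempered B hB')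
    (φ : X₂.Pi →ₜ* X₁.Pi) (hφ : Function.Surjective φ) (η : h.Ψbs.functor ≅ BTemp.res φ) :
    S₂.Hodot = S₁.Hodot.comap φ.toMonoidHom := by
  obtain ⟨h₁', e₁⟩ := hg₁ (S₁.base.obj S₁.Aodot) S₁.isGalois_Aodot
  obtain ⟨h₂', e₂⟩ := hg₂ (S₂.base.obj S₂.Aodot) S₂.isGalois_Aodot
  obtain ⟨e⟩ := h.mapsAodot
  have hFA : SemiGraphs.IsGaloisObj (h.Ψbs.functor.obj (S₁.base.obj S₁.Aodot)) :=
    isGaloisObj_of_iso_res X₁.isTempered X₂.isTempered φ hφ η _ h₁'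
  change (S₂.galoisSurj (S₂.base.obj S₂.Aodot) S₂.isGalois_Aodot).ker =
    (S₁.galoisSurj (S₁.base.obj S₁.Aodot) S₁.isGalois_Aodot).ker.comap φ.toMonoidHom
  rw [e₁, e₂, ker_galoisSurjOf_eq_of_iso X₂.isTempered e.symm h₂' hFA,
    ker_galoisSurjOf_of_iso_res X₁.isTempered X₂.isTempered φ hφ η _ h₁' hFA]

/-- **T44-L09 `HodotCompatible` PROVED at the temperoid base**: there is an isomorphism of topological groups
`θ : Π^tp_{X₁} ⥲ Π^tp_{X₂}` with `θ(H_{⊙,1}) = H_{⊙,2}` — namely `θ := φ⁻¹` for the pin `Ψ^bs ≅ B^temp(φ)` (Thm. 4.4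
(i) clause 3 «`Ψ^bs` induces an isomorphism `H_{⊙,1} ⥲ H_{⊙,2}`»; SUBDAG-EtTh-Thm44 row T44-L09, OPEN owner ∅ until
now: the [SemiAnbd] Prop. 3.2 bridge). [cite: MochizukiEtTh2009, Thm 4.4 (i) p.320 (PDF p.94)] -/
theorem Thm44Hyp.hodotCompatible_ofTemperoid (h : Thm44Hyp S₁ S₂)
    (hg₁ : ∀ (A : BTemp X₁.Pi) (hA : S₁.IsGaloisObj A),
      ∃ hA' : SemiGraphs.IsGaloisObj A, S₁.galoisSurj A hA = galoisSurjOf X₁.isTempered A hA')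
    (hg₂ : ∀ (B : BTemp X₂.Pi) (hB : S₂.IsGaloisObj B),
      ∃ hB' : SemiGraphs.IsGaloisObj B, S₂.galoisSurj B hB = galoisSurjOf X₂.isTempered B hB') :
    h.HodotCompatible := by
  obtain ⟨φ, ψ, hψφ, hφψ, ⟨η⟩, -⟩ := h.exists_res_iso
  let θ : X₁.Pi ≃ₜ* X₂.Pi :=
    { toFun := ψ, invFun := φ, left_inv := hφψ, right_inv := hψφ, map_mul' := fun x y => map_mul ψ x y
      continuous_toFun := ψ.continuous, continuous_invFun := φ.continuous }
  have hθ : θ.toMulEquiv.symm.toMonoidHom = φ.toMonoidHom := MonoidHom.ext fun _ => rfl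
  refine ⟨θ, ?_⟩
  rw [Subgroup.map_equiv_eq_comap_symm', hθ]
  exact (h.hodot_eq_comap hg₁ hg₂ φ (fun x => ⟨ψ x, hφψ x⟩) η).symm

/-! ### T44-L09c: the transport law `hT` and `GaloisCompatible` -/

/-- **The transport law (binder `hT`) PROVED at the temperoid base**: for the pin `Ψ^bs ≅ B^temp(φ)` with inverse
`ψ` and a Galois `A ∈ Ob(C₁)` there is `c ∈ Π^tp_{X₂}` with `transportBaseAut_A(galoisSurj₁(g)) =
galoisSurj₂(c·ψ(g)·c⁻¹)` for all `g ∈ Π^tp_{X₁}` («`Ψ^bs` induces … well-defined up to composition with inner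
automorphisms»): gen 2's `galoisSurjOf_res` moved along `Ψ^bs ≅ B^temp(φ)` and along `c_A : Ψ^bs(A^bs) ≅ (Ψ A)^bs`.
[cite: MochizukiEtTh2009, Thm 4.4 (i) p.320 (PDF p.94)] -/
theorem Thm44Hyp.transportBaseAut_galoisSurj (h : Thm44Hyp S₁ S₂)
    (hg₁ : ∀ (A : BTemp X₁.Pi) (hA : S₁.IsGaloisObj A),
      ∃ hA' : SemiGraphs.IsGaloisObj A, S₁.galoisSurj A hA = galoisSurjOf X₁.isTempered A hA')
    (hg₂ : ∀ (B : BTemp X₂.Pi) (hB : S₂.IsGaloisObj B),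
      ∃ hB' : SemiGraphs.IsGaloisObj B, S₂.galoisSurj B hB = galoisSurjOf X₂.isTempered B hB')
    (φ : X₂.Pi →ₜ* X₁.Pi) (ψ : X₁.Pi →ₜ* X₂.Pi) (hφψ : ∀ y, φ (ψ y) = y) (η : h.Ψbs.functor ≅ BTemp.res φ)
    (A : S₁.C) (hA : S₁.IsGalois A) (hA₂ : S₂.IsGalois (h.Ψ.functor.obj A)) :
    ∃ c : X₂.Pi, ∀ g : X₁.Pi,
      h.transportBaseAut A (S₁.galoisSurj (S₁.base.obj A) hA g) =
        S₂.galoisSurj (S₂.base.obj (h.Ψ.functor.obj A)) hA₂ (c * ψ g * c⁻¹) := by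
  have hφ : Function.Surjective φ := fun x => ⟨ψ x, hφψ x⟩
  obtain ⟨hA', e₁⟩ := hg₁ (S₁.base.obj A) hA
  obtain ⟨hB', e₂⟩ := hg₂ (S₂.base.obj (h.Ψ.functor.obj A)) hA₂
  have hFA : SemiGraphs.IsGaloisObj (h.Ψbs.functor.obj (S₁.base.obj A)) :=
    isGaloisObj_of_iso_res X₁.isTempered X₂.isTempered φ hφ η _ hA'
  obtain ⟨c₁, hc₁⟩ := galoisSurjOf_of_iso_res X₁.isTempered X₂.isTempered φ hφ η (S₁.base.obj A) hA' hFA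
  obtain ⟨c₂, hc₂⟩ := galoisSurjOf_iso_conj X₂.isTempered (h.cmp A) hFA hB'
  refine ⟨c₂ * c₁, fun g => ?_⟩
  rw [e₁, e₂]
  apply Iso.ext
  have h1 := hc₁ (ψ g)
  rw [hφψ] at h1
  have h2 := hc₂ (c₁ * ψ g * c₁⁻¹)
  rw [h.transportBaseAut_hom, h1, h2, show c₂ * (c₁ * ψ g * c₁⁻¹) * c₂⁻¹ = c₂ * c₁ * ψ g * (c₂ * c₁)⁻¹ by group]

/-- **T44-L09c `GaloisCompatible` PROVED at the temperoid base** (SUBDAG-EtTh-Thm44 row T44-L09c, typed by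
abc-iut-L2-t3, DERIVED mod the binders `θ/hθ/hG/hT` by gen 2's `galoisCompatible_of`): for every Galois
`A ∈ Ob(C₁)`, `Ψ(A)` is Galois and the isomorphism `Aut_{D₁}(A^bs) ⥲ Aut_{D₂}((Ψ A)^bs)` induced by `Ψ^bs` carries
`H_A^bs` onto `H_{Ψ A}^bs` — ALL FOUR BINDERS DISCHARGED by the pin `Ψ^bs ≅ B^temp(φ)` ([SemiAnbd] Prop. 3.2):
`θ := φ⁻¹`, `hθ := hodot_eq_comap`, `hG := isGalois_map_ofTemperoid`, `hT := transportBaseAut_galoisSurj`.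
[cite: MochizukiEtTh2009, Thm 4.4 (i) p.320 (PDF p.94)] -/
theorem Thm44Hyp.galoisCompatible_ofTemperoid (h : Thm44Hyp S₁ S₂)
    (hg₁ : ∀ (A : BTemp X₁.Pi) (hA : S₁.IsGaloisObj A),
      ∃ hA' : SemiGraphs.IsGaloisObj A, S₁.galoisSurj A hA = galoisSurjOf X₁.isTempered A hA')
    (hI₂ : ∀ B : BTemp X₂.Pi, SemiGraphs.IsGaloisObj B → S₂.IsGaloisObj B)
    (hg₂ : ∀ (B : BTemp X₂.Pi) (hB : S₂.IsGaloisObj B),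
      ∃ hB' : SemiGraphs.IsGaloisObj B, S₂.galoisSurj B hB = galoisSurjOf X₂.isTempered B hB') :
    h.GaloisCompatible := by
  obtain ⟨φ, ψ, hψφ, hφψ, ⟨η⟩, -⟩ := h.exists_res_iso
  let θ : X₁.Pi ≃ₜ* X₂.Pi :=
    { toFun := ψ, invFun := φ, left_inv := hφψ, right_inv := hψφ, map_mul' := fun x y => map_mul ψ x y
      continuous_toFun := ψ.continuous, continuous_invFun := φ.continuous }
  have hθ : θ.toMulEquiv.symm.toMonoidHom = φ.toMonoidHom := MonoidHom.ext fun _ => rfl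
  have hθmap : S₁.Hodot.map θ.toMulEquiv.toMonoidHom = S₂.Hodot := by
    rw [Subgroup.map_equiv_eq_comap_symm', hθ]
    exact (h.hodot_eq_comap hg₁ hg₂ φ (fun x => ⟨ψ x, hφψ x⟩) η).symm
  exact h.galoisCompatible_of θ.toMulEquiv hθmap (h.isGalois_map_ofTemperoid hg₁ hI₂) fun A hA =>
    h.transportBaseAut_galoisSurj hg₁ hg₂ φ ψ hφψ η A hA (h.isGalois_map_ofTemperoid hg₁ hI₂ A hA)

/-! ### Consequences by name: T44-L08 and Thm. 4.4 (i) -/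

/-- **T44-L08 at the temperoid base**: `Ψ` carries `H_{⊙,1}`-ample objects to `H_{⊙,2}`-ample objects (Thm. 4.4 (i)
clause 2) — abc-iut-L2-t3's `preservesAmple_of` fed with `galoisCompatible_ofTemperoid`.
[cite: MochizukiEtTh2009, Thm 4.4 (i) p.320 (PDF p.94)] -/
theorem Thm44Hyp.preservesAmple_ofTemperoid (h : Thm44Hyp S₁ S₂)
    (hg₁ : ∀ (A : BTemp X₁.Pi) (hA : S₁.IsGaloisObj A),
      ∃ hA' : SemiGraphs.IsGaloisObj A, S₁.galoisSurj A hA = galoisSurjOf X₁.isTempered A hA')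
    (hI₂ : ∀ B : BTemp X₂.Pi, SemiGraphs.IsGaloisObj B → S₂.IsGaloisObj B)
    (hg₂ : ∀ (B : BTemp X₂.Pi) (hB : S₂.IsGaloisObj B),
      ∃ hB' : SemiGraphs.IsGaloisObj B, S₂.galoisSurj B hB = galoisSurjOf X₂.isTempered B hB') :
    h.PreservesAmple :=
  h.preservesAmple_of (h.galoisCompatible_ofTemperoid hg₁ hI₂ hg₂)

/-- **Thm. 4.4 (i) at the temperoid base from the printed proof's remaining inputs ONLY**: «`C₂` is a Frobenioid»
([FrdI] Thm. 5.2 (ii)) and T44-L03 ([FrdI] Thm. 3.4 (ii)(iii) at `Ψ`) — the [SemiAnbd] inputs T44-L09c / T44-L09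
of abc-iut-L2-t3's `thm44_i_of_inputs` are now theorems. [cite: MochizukiEtTh2009, Thm 4.4 (i) p.320 (PDF p.94)] -/
theorem Thm44Hyp.thm44_i_ofTemperoid (h : Thm44Hyp S₁ S₂)
    (hg₁ : ∀ (A : BTemp X₁.Pi) (hA : S₁.IsGaloisObj A),
      ∃ hA' : SemiGraphs.IsGaloisObj A, S₁.galoisSurj A hA = galoisSurjOf X₁.isTempered A hA')
    (hI₂ : ∀ B : BTemp X₂.Pi, SemiGraphs.IsGaloisObj B → S₂.IsGaloisObj B)
    (hg₂ : ∀ (B : BTemp X₂.Pi) (hB : S₂.IsGaloisObj B),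
      ∃ hB' : SemiGraphs.IsGaloisObj B, S₂.galoisSurj B hB = galoisSurjOf X₂.isTempered B hB')
    (hF₂ : PreFrobenioid.IsFrobenioid S₂.F) (h3 : h.PreservesFrobeniusStructure) : Thm44_i h :=
  h.thm44_i_of_inputs hF₂ h3 (h.galoisCompatible_ofTemperoid hg₁ hI₂ hg₂) (h.hodotCompatible_ofTemperoid hg₁ hg₂)

end OfTemperoid

/-! ### The literal instances for abc-iut-L2-t4's `BiKummerSetting.mkOfTemperoid` -/

section MkOfTemperoid

variable (tf₁ : TemperedFrobenioid T₁ (BTemp X₁.Pi) VD₁) (hZ₁ : tf₁.monoidType = MonoidType.Z)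
  (hP₁ : ∀ A : (BTemp X₁.Pi)ᵒᵖ, IsPerfect (tf₁.Φ.carrier A))
  (NH₁ : Subgroup (Field.absoluteGaloisGroup K) → tf₁.category → ℕ+ → Prop) (A₁ : tf₁.category)
  (hA₁ : PreFrobenioid.IsFrobeniusTrivial tf₁.toElem A₁) (hA₁' : SemiGraphs.IsGaloisObj A₁.base)
  (tf₂ : TemperedFrobenioid T₂ (BTemp X₂.Pi) VD₂) (hZ₂ : tf₂.monoidType = MonoidType.Z)
  (hP₂ : ∀ B : (BTemp X₂.Pi)ᵒᵖ, IsPerfect (tf₂.Φ.carrier B))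
  (NH₂ : Subgroup (Field.absoluteGaloisGroup K') → tf₂.category → ℕ+ → Prop) (A₂ : tf₂.category)
  (hA₂ : PreFrobenioid.IsFrobeniusTrivial tf₂.toElem A₂) (hA₂' : SemiGraphs.IsGaloisObj A₂.base)

/-- **T44-L09 `HodotCompatible` for the settings `mkOfTemperoid`** (the three «Galois data from the temperoid»
hypotheses are `⟨hA, rfl⟩` / `id` there). [cite: MochizukiEtTh2009, Thm 4.4 (i) p.320 (PDF p.94)] -/
theorem Thm44Hyp.hodotCompatible_mkOfTemperoid
    (h : Thm44Hyp (mkOfTemperoid X₁ tf₁ hZ₁ hP₁ NH₁ A₁ hA₁ hA₁') (mkOfTemperoid X₂ tf₂ hZ₂ hP₂ NH₂ A₂ hA₂ hA₂')) :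
    h.HodotCompatible :=
  h.hodotCompatible_ofTemperoid (fun _ hA => ⟨hA, rfl⟩) (fun _ hB => ⟨hB, rfl⟩)

/-- **T44-L09c `GaloisCompatible` for the settings `mkOfTemperoid`**. [cite: MochizukiEtTh2009, Thm 4.4 (i) p.320 (PDF p.94)] -/
theorem Thm44Hyp.galoisCompatible_mkOfTemperoid
    (h : Thm44Hyp (mkOfTemperoid X₁ tf₁ hZ₁ hP₁ NH₁ A₁ hA₁ hA₁') (mkOfTemperoid X₂ tf₂ hZ₂ hP₂ NH₂ A₂ hA₂ hA₂')) :
    h.GaloisCompatible :=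
  h.galoisCompatible_ofTemperoid (fun _ hA => ⟨hA, rfl⟩) (fun _ hB => hB) (fun _ hB => ⟨hB, rfl⟩)

/-- **T44-L08 `PreservesAmple` for the settings `mkOfTemperoid`**. [cite: MochizukiEtTh2009, Thm 4.4 (i) p.320 (PDF p.94)] -/
theorem Thm44Hyp.preservesAmple_mkOfTemperoid
    (h : Thm44Hyp (mkOfTemperoid X₁ tf₁ hZ₁ hP₁ NH₁ A₁ hA₁ hA₁') (mkOfTemperoid X₂ tf₂ hZ₂ hP₂ NH₂ A₂ hA₂ hA₂')) :
    h.PreservesAmple :=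
  h.preservesAmple_ofTemperoid (fun _ hA => ⟨hA, rfl⟩) (fun _ hB => hB) (fun _ hB => ⟨hB, rfl⟩)

/-- **Thm. 4.4 (i) for the settings `mkOfTemperoid`** from «`C₂` is a Frobenioid» and T44-L03 only.
[cite: MochizukiEtTh2009, Thm 4.4 (i) p.320 (PDF p.94)] -/
theorem Thm44Hyp.thm44_i_mkOfTemperoid
    (h : Thm44Hyp (mkOfTemperoid X₁ tf₁ hZ₁ hP₁ NH₁ A₁ hA₁ hA₁') (mkOfTemperoid X₂ tf₂ hZ₂ hP₂ NH₂ A₂ hA₂ hA₂'))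
    (hF₂ : PreFrobenioid.IsFrobenioid (mkOfTemperoid X₂ tf₂ hZ₂ hP₂ NH₂ A₂ hA₂ hA₂').F)
    (h3 : h.PreservesFrobeniusStructure) : Thm44_i h :=
  h.thm44_i_ofTemperoid (fun _ hA => ⟨hA, rfl⟩) (fun _ hB => hB) (fun _ hB => ⟨hB, rfl⟩) hF₂ h3

end MkOfTemperoid

end BiKummerSetting

end Literature.AnabelianGeometry.EtaleTheta

end
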